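import Mathlib
import Summits.KontsevichZagierPeriods.Zeta5Search.TypeSpaceLawZeroFinal
import Summits.KontsevichZagierPeriods.Zeta5Search.TypeSpaceLawOriginTwoSided
import HarnessLib

/-!
# ζ(5) search — gen-2 g13 P.S.: gen-2 g11's TYPE-SPACE LAWS on the record ray BELOW `θ = 2`
# (cell `pub-zeta5`; HONEST FRAMING: systematic search; no irrationality claim unless certified)

`REPORT-gen2-g13.md` §8 (P.S.).  After THEOREM A⁗ (`RecordWindowsA4.LawA4`) and THEOREM L5 (`SecondResidueLaw.LawA5`) the record-ray gap windows
left below `θ = p/n = 2` are those on which g12's palindromic frame fails ("several deep types", "class of exponent `−M+1` not a raise").  They are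
NOT new territory: they are instances of gen-2 g11's type-space laws of `ResidueLaw`, which g11 instantiated only at `θ > 17/9`
(`RecWindowM10 … RecWindowM28`):
* ZERO regime — `TypeSpaceLawZero` (`casLB + 3 = 6 − 2M`), A THEOREM (`typeSpaceLawZero_holds`): windows `M = 36, 60, 64, 68, 76` below;
* ORIGIN regime — `TypeSpaceLawOrigin` (`casLB + 2 = 5 − 2M`; conjectural as stated, its two-sided form
  `SecondOrder.typeSpaceLawOrigin_twoSided` is a theorem): windows `M = 38, 46, 54, 62` below (and g11's `M = 28`);
* ODD depth (`N = 29, 33, 35, 83, 107` at eight lattice positions below `θ = 2`) is gen-2 g9's COLLINEARITY CRITERION, a tree theorem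
  (`collinearityCriterion_holds`, `casLB + 1`) — companion file `OddDepthWindows` (licences `ccGuard_bRec`, `collin_bRec`; windows `N = 29, 33`).
Per window this file records (i) a BOOKKEEPING statement (`@[conjecture] RecTSClasses…`: the law's class hypotheses at every instance of the
window WHERE THE NOMINAL DEPTH IS REALISED (guard `DepthRealised`, below) — decidable per instance; verified by `g13/tsl13.py` = g11's `lawW.config`
on light class data for every window prime with `n ≤ 150` (`n ≤ 130/125` for `M = 62, 68 / 76`), 0 exceptions), (ii) the window bound (`@[conjecture] RecWindowTS…`), (iii) the PROVED reduction: a ZERO window follows from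
its bookkeeping statement ALONE (the law is a theorem; same pattern as census g21's `ZeroWindowClasses.lean` for g11's five zero windows above
`θ = 17/9`), an ORIGIN window from bookkeeping + `TypeSpaceLawOrigin` — or, instance by instance and unconditionally, from the TWO-SIDED bookkeeping
`RecTSOriginClasses₂` via p3's theorem (`tsOrigin₂_bRec`; the `HD′` half is not verified by this seat).  The degree condition `DEG` of the laws
is the window's upper edge (`θ ≤ 50/(M−2)`) or weaker, via `Σ_x E_x = −(2d+5)`, `d = 25n` (`sum_classExp_range`).
Exact truths on the windows (`g12/vpadic.py`, p-adic Newton/crossing scheme, ≥ 37 certified digits; `v = v_p(Cas₇(b(n)))`):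
`M=36`: (32,47) −66 · `M=38`: (34,47), (53,73) −71 · `M=46`: (38,43), (47,53), (54,61) −87 · `M=54`: (71,67) −103 · `M=60`: (71,61), (78,67) −114 ·
`M=62`: (64,53) −119, (71,59) −118 · `M=68`: (78,59), (81,61) −130 · `M=76`: (100,67) −146 · odd `m=−33`: (26,41), (45,71) −62 · `M=28` (g11): (12,23),
(28,53), (31,59) −51 — in every case the bound below is attained at the smallest instances (it is the generic truth of the window,
one letter above the census-proved column, and equals the Brown–Zudilin denominator exponent `e_G` of g11's gap table there).
`p`-adic valuations of explicit rational numbers; nothing in this file bears on irrationality.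
-/

open Finset

namespace Summit.KontsevichZagierPeriods.Zeta5Search.ResidueLaw

open Summit.KontsevichZagierPeriods.Zeta5Search.ClusterValuation
open Summit.KontsevichZagierPeriods.Zeta5Search.CasoratianValuation (InPolytope shift casoratian)
open Summit.KontsevichZagierPeriods.Zeta5Search.SecondOrder (classTypeList typeSpaceLawOrigin_twoSided)
open Summit.KontsevichZagierPeriods.Zeta5Search.WedgeDictionary (dOf)

/-! ## §1 Bookkeeping predicates: the class hypotheses of the two laws at a record instance `b = bRec n` -/

/-- The window's NOMINAL DEPTH is realised at the instance: the minimum multipole class exponent of `b(n)` at `p` is EXACTLY `−M` (no pole class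
below `−M`, some multipole class at `−M`).  Windows are θ-intervals, but the class structure depends on the lattice position of `p`, not on θ alone:
within `O(1/n)` of an edge the deepest class can be one level off — (114,167) on the `M = 36` window has `m = −35`, (120,107) on the `M = 58` window
has `m = −57` — and on (41/26, 19/12] BOTH parities occur (`m = −33` at (26,41), (45,71), (64,101); `m = −34` at (50,79), (69,109), (83,131), …).  Every window
statement below therefore carries this decidable guard and claims nothing where the guard fails. -/
def DepthRealised (n p M : ℕ) : Prop :=
  (∀ x, x < p → 1 ≤ classPoleCount (bRec n) p x → -(M : ℤ) ≤ classExp (bRec n) p x) ∧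
  ∃ x, x < p ∧ 2 ≤ classPoleCount (bRec n) p x ∧ classExp (bRec n) p x = -(M : ℤ)

/-- ZERO-regime class data of `TypeSpaceLawZero` at `(bRec n, p, M)`: every pole class has exponent `≥ −M`; the classes of exponent `−M` are
non-central with palindromic type list; the doubled orbit points of the live classes are affinely collinear mod `p`. -/
def RecTSZeroClasses (n p M : ℕ) : Prop :=
  (∀ x, x < p → 1 ≤ classPoleCount (bRec n) p x → -(M : ℤ) ≤ classExp (bRec n) p x) ∧
  (∀ x, x < p → 1 ≤ classPoleCount (bRec n) p x → classExp (bRec n) p x = -(M : ℤ) →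
      ¬ CentreIn (bRec n) p x ∧ (classTypeList (bRec n) p x).reverse = classTypeList (bRec n) p x) ∧
  (∀ x ∈ liveClasses (bRec n) p M, ∀ y ∈ liveClasses (bRec n) p M, ∀ z ∈ liveClasses (bRec n) p M,
      affDet (bRec n) p M x y z = 0 ∨ 1 ≤ padicValRat p (affDet (bRec n) p M x y z))

/-- ORIGIN-regime class data of `TypeSpaceLawOrigin` at `(bRec n, p, M)`: exponents `≥ −M`; SOME primitive direction `u` (not `≡ 0 mod p`) carries
every exact deep orbit vector, the deep classes are non-central, and the point differences of the live classes are parallel to `u` mod `p`.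
(On the windows below the deep classes come in conjugate pairs of mutually reversed NON-palindromic type lists; `u` is the direction of
`σ(S) − σ(S^rev)`, the same for every deep pair of the instance — g11's "regime origin, dim 𝒲 = 1, 𝒲 ⊂ line P₁".) -/
def RecTSOriginClasses (n p M : ℕ) : Prop :=
  (∀ x, x < p → 1 ≤ classPoleCount (bRec n) p x → -(M : ℤ) ≤ classExp (bRec n) p x) ∧
  ∃ u : ℤ × ℤ, ¬ ((p : ℤ) ∣ u.1 ∧ (p : ℤ) ∣ u.2) ∧
    (∀ x, x < p → 1 ≤ classPoleCount (bRec n) p x → classExp (bRec n) p x = -(M : ℤ) →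
        ¬ CentreIn (bRec n) p x ∧
        (u.1 : ℚ) * (vHat (bRec n) p x - vHat (bRec n) p (conjClass (bRec n) p x))
          - (u.2 : ℚ) * (wHat (bRec n) p x - wHat (bRec n) p (conjClass (bRec n) p x)) = 0) ∧
    (∀ x ∈ liveClasses (bRec n) p M, ∀ y ∈ liveClasses (bRec n) p M,
        dirDet (bRec n) p M u x y = 0 ∨ 1 ≤ padicValRat p (dirDet (bRec n) p M u x y))

/-- TWO-SIDED origin class data (the hypotheses of p3's THEOREM `SecondOrder.typeSpaceLawOrigin_twoSided` at `(bRec n, p, M)`): as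
`RecTSOriginClasses`, plus the parallelism `HD′` of the point differences of the live classes of the SHIFTED vector `b(n)+e₇` (same `M`, same `u`).
This seat verified the one-sided data on the windows below (n ≤ 150), NOT `HD′` (census g21's `twosided.py` is the exact checker; at instances where the hit
`+e₇` lands in a deep class — e.g. (53,73) on the `M = 38` window — `HD′` is exactly p3's open transport point), so no two-sided window statement is filed here;
the PROVED pointwise reduction `tsOrigin₂_bRec` below is what a census seat needs to certify an origin window unconditionally instance by instance. -/
def RecTSOriginClasses₂ (n p M : ℕ) : Prop :=
  (∀ x, x < p → 1 ≤ classPoleCount (bRec n) p x → -(M : ℤ) ≤ classExp (bRec n) p x) ∧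
  ∃ u : ℤ × ℤ, ¬ ((p : ℤ) ∣ u.1 ∧ (p : ℤ) ∣ u.2) ∧
    (∀ x, x < p → 1 ≤ classPoleCount (bRec n) p x → classExp (bRec n) p x = -(M : ℤ) →
        ¬ CentreIn (bRec n) p x ∧
        (u.1 : ℚ) * (vHat (bRec n) p x - vHat (bRec n) p (conjClass (bRec n) p x))
          - (u.2 : ℚ) * (wHat (bRec n) p x - wHat (bRec n) p (conjClass (bRec n) p x)) = 0) ∧
    (∀ x ∈ liveClasses (bRec n) p M, ∀ y ∈ liveClasses (bRec n) p M,
        dirDet (bRec n) p M u x y = 0 ∨ 1 ≤ padicValRat p (dirDet (bRec n) p M u x y)) ∧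
    (∀ x ∈ liveClasses (shift (bRec n) 7) p M, ∀ y ∈ liveClasses (shift (bRec n) 7) p M,
        dirDet (shift (bRec n) 7) p M u x y = 0 ∨ 1 ≤ padicValRat p (dirDet (shift (bRec n) 7) p M u x y))

/-! ## §2 The two laws at a record instance (PROVED reductions) -/

/-- A window prime with `p² > 41n+2`, `n ≥ 2` is at least `5`. -/
private theorem five_le_of_sq' (n p : ℕ) (hn : 2 ≤ n) (h : 41 * n + 2 < p ^ 2) : 5 ≤ p := by
  by_contra hc
  have hp4 : p ≤ 4 := by omega
  have : p ^ 2 ≤ 4 ^ 2 := Nat.pow_le_pow_left hp4 2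
  omega

/-- `b₀` of the record ray is `41n`. -/
private theorem bRec_zero_int (n : ℕ) : bRec n 0 = 41 * (n : ℤ) := by
  simp [bRec]; ring

/-- `d(b(n)) = 25n` on the record ray. -/
private theorem dOf_bRec' (n : ℕ) : dOf (bRec n) = 25 * (n : ℤ) := by
  simp [dOf, bRec, Finset.sum_range_succ]; ring

/-- **ZERO law at a record instance (PROVED, from the theorem `typeSpaceLawZero_holds`)**: the bookkeeping `RecTSZeroClasses n p M` and the degree
condition `p(M−2) ≤ 50n+1` give `v_p(Cas₇(b(n))) ≥ 6 − 2M`. -/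
theorem tsZero_bRec (n p M : ℕ) (hn : 2 ≤ n) (hp : p.Prime) (hpn : p ≤ 41 * n) (hsq : 41 * n + 2 < p ^ 2) (hM : 6 ≤ M) (hMe : Even M)
    (hC : RecTSZeroClasses n p M) (hdeg : (p : ℤ) * ((M : ℤ) - 2) ≤ 50 * (n : ℤ) + 1) (hne : casoratian (bRec n) 7 ≠ 0) :
    (6 : ℤ) - 2 * M ≤ padicValRat p (casoratian (bRec n) 7) := by
  obtain ⟨c1, c2, c3⟩ := hC
  haveI : Fact p.Prime := ⟨hp⟩
  have h5 : 5 ≤ p := five_le_of_sq' n p hn hsq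
  have hpb : (p : ℤ) ≤ bRec n 0 := by rw [bRec_zero_int]; exact_mod_cast hpn
  have hp2 : (bRec n 0 + 2 : ℤ) < (p : ℤ) ^ 2 := by rw [bRec_zero_int]; exact_mod_cast hsq
  have hsum := sum_classExp_range (bRec n) (inPolytope_bRec n) h5
  have hd : (p : ℤ) * ((M : ℤ) - 2) + ∑ x ∈ range p, classExp (bRec n) p x ≤ -4 := by
    rw [hsum, dOf_bRec']; linarith
  exact typeSpaceLawZero_holds (bRec n) p 7 M (inPolytope_bRec n) (inPolytope_shift_bRec n 7 (by omega) (by norm_num) (by norm_num))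
    (by norm_num) (by norm_num) hp h5 hpb hp2 hM hMe c1 c2 hd c3 hne

/-- **ORIGIN law at a record instance (PROVED reduction)**: `TypeSpaceLawOrigin`, the bookkeeping `RecTSOriginClasses n p M` and the degree condition
give `v_p(Cas₇(b(n))) ≥ 5 − 2M`. -/
theorem tsOrigin_bRec (hO : TypeSpaceLawOrigin) (n p M : ℕ) (hn : 2 ≤ n) (hp : p.Prime) (hpn : p ≤ 41 * n) (hsq : 41 * n + 2 < p ^ 2)
    (hM : 6 ≤ M) (hMe : Even M) (hC : RecTSOriginClasses n p M) (hdeg : (p : ℤ) * ((M : ℤ) - 2) ≤ 50 * (n : ℤ) + 1)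
    (hne : casoratian (bRec n) 7 ≠ 0) : (5 : ℤ) - 2 * M ≤ padicValRat p (casoratian (bRec n) 7) := by
  obtain ⟨c1, u, hu, c2, c3⟩ := hC
  haveI : Fact p.Prime := ⟨hp⟩
  have h5 : 5 ≤ p := five_le_of_sq' n p hn hsq
  have hpb : (p : ℤ) ≤ bRec n 0 := by rw [bRec_zero_int]; exact_mod_cast hpn
  have hp2 : (bRec n 0 + 2 : ℤ) < (p : ℤ) ^ 2 := by rw [bRec_zero_int]; exact_mod_cast hsq
  have hsum := sum_classExp_range (bRec n) (inPolytope_bRec n) h5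
  have hd : (p : ℤ) * ((M : ℤ) - 2) + ∑ x ∈ range p, classExp (bRec n) p x ≤ -4 := by
    rw [hsum, dOf_bRec']; linarith
  exact hO (bRec n) p 7 M u (inPolytope_bRec n) (inPolytope_shift_bRec n 7 (by omega) (by norm_num) (by norm_num))
    (by norm_num) (by norm_num) hp h5 hpb hp2 hM hMe hu c1 c2 hd c3 hne

/-- **ORIGIN law at a record instance, TWO-SIDED form (PROVED, UNCONDITIONAL — from p3's theorem `typeSpaceLawOrigin_twoSided`)**:
`RecTSOriginClasses₂ n p M` and the degree condition give `v_p(Cas₇(b(n))) ≥ 5 − 2M`. -/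
theorem tsOrigin₂_bRec (n p M : ℕ) (hn : 2 ≤ n) (hp : p.Prime) (hpn : p ≤ 41 * n) (hsq : 41 * n + 2 < p ^ 2)
    (hM : 6 ≤ M) (hMe : Even M) (hC : RecTSOriginClasses₂ n p M) (hdeg : (p : ℤ) * ((M : ℤ) - 2) ≤ 50 * (n : ℤ) + 1)
    (hne : casoratian (bRec n) 7 ≠ 0) : (5 : ℤ) - 2 * M ≤ padicValRat p (casoratian (bRec n) 7) := by
  obtain ⟨c1, u, hu, c2, c3, c4⟩ := hC
  haveI : Fact p.Prime := ⟨hp⟩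
  have h5 : 5 ≤ p := five_le_of_sq' n p hn hsq
  have hpb : (p : ℤ) ≤ bRec n 0 := by rw [bRec_zero_int]; exact_mod_cast hpn
  have hp2 : (bRec n 0 + 2 : ℤ) < (p : ℤ) ^ 2 := by rw [bRec_zero_int]; exact_mod_cast hsq
  have hsum := sum_classExp_range (bRec n) (inPolytope_bRec n) h5
  have hd : (p : ℤ) * ((M : ℤ) - 2) + ∑ x ∈ range p, classExp (bRec n) p x ≤ -4 := by
    rw [hsum, dOf_bRec']; linarith
  exact typeSpaceLawOrigin_twoSided (bRec n) (inPolytope_bRec n) (inPolytope_shift_bRec n 7 (by omega) (by norm_num) (by norm_num))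
    (by norm_num) (by norm_num) h5 hpb hp2 hM hMe u hu c1 c2 hd c3 c4 hne

/-! ## §3 The windows below `θ = 2` (θ = p/n; integer forms; window primes `p² > 41n + 2`)

| window (θ) | integer form | regime | M | casLB | census-proved | NEW bound | exact instances (n,p): v |
|---|---|---|---|---|---|---|---|
| (41/28, 25/17] | 41n < 28p, 17p ≤ 25n | zero | 36 | −69 | −67 | **−66** | (32,47): −66 |
| (11/8, 18/13] | 11n < 8p, 13p ≤ 18n | origin | 38 | −73 | −72 | **−71** | (34,47) (53,73): −71 |
| (9/8, 17/15] | 9n < 8p, 15p ≤ 17n | origin | 46 | −89 | −88 | **−87** | (38,43) (47,53) (54,61): −87 |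
| (16/17, 17/18] | 16n < 17p, 18p ≤ 17n | origin | 54 | −105 | −104 | **−103** | (71,67): −103 |
| (6/7, 25/29] | 6n < 7p, 29p ≤ 25n | zero | 60 | −117 | −115 | **−114** | (71,61) (78,67): −114 |
| (14/17, 5/6] | 14n < 17p, 6p ≤ 5n | origin | 62 | −121 | −120 | **−119** | (64,53): −119, (71,59): −118 |
| (41/51, 25/31] | 41n < 51p, 31p ≤ 25n | zero | 64 | −125 | −123 | **−122** | — (4 window primes n ≤ 150, no exact run) |
| (3/4, 25/33] | 3n < 4p, 33p ≤ 25n | zero | 68 | −133 | −131 | **−130** | (78,59) (81,61): −130 |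
| (2/3, 25/37] | 2n < 3p, 37p ≤ 25n | zero | 76 | −149 | −147 | **−146** | (100,67): −146 |
-/

/-- Bookkeeping, window `M = 36` (zero): verified at every window prime with `n ≤ 150`: 12/12 with the depth realised ((114,167) has `m = −35`: guard fails, nothing claimed; truth there −66 = casLB+1 by the odd orbit criterion). -/
@[conjecture] def RecTSClassesZ36 : Prop :=
  ∀ n p : ℕ, 2 ≤ n → p.Prime → 41 * n < 28 * p → 17 * p ≤ 25 * n → 41 * n + 2 < p ^ 2 → DepthRealised n p 36 →
    RecTSZeroClasses n p 36

/-- **RECORD WINDOW, type-space zero, `M = 36`** (`41/28 < θ ≤ 25/17`; casLB = −69): `v_p(Cas₇(b(n))) ≥ −66`. -/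
@[conjecture] def RecWindowTSM36 : Prop :=
  ∀ n p : ℕ, 2 ≤ n → p.Prime → 41 * n < 28 * p → 17 * p ≤ 25 * n → 41 * n + 2 < p ^ 2 → DepthRealised n p 36 →
    casoratian (bRec n) 7 ≠ 0 → (-66 : ℤ) ≤ padicValRat p (casoratian (bRec n) 7)

/-- Bookkeeping, window `M = 38` (origin): verified at every window prime with `n ≤ 150` (21/21, depth realised at all). -/
@[conjecture] def RecTSClassesO38 : Prop :=
  ∀ n p : ℕ, 2 ≤ n → p.Prime → 11 * n < 8 * p → 13 * p ≤ 18 * n → 41 * n + 2 < p ^ 2 → DepthRealised n p 38 →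
    RecTSOriginClasses n p 38

/-- **RECORD WINDOW, type-space origin, `M = 38`** (`11/8 < θ ≤ 18/13`; casLB = −73): `v_p(Cas₇(b(n))) ≥ −71`. -/
@[conjecture] def RecWindowTSM38 : Prop :=
  ∀ n p : ℕ, 2 ≤ n → p.Prime → 11 * n < 8 * p → 13 * p ≤ 18 * n → 41 * n + 2 < p ^ 2 → DepthRealised n p 38 →
    casoratian (bRec n) 7 ≠ 0 → (-71 : ℤ) ≤ padicValRat p (casoratian (bRec n) 7)

/-- Bookkeeping, window `M = 46` (origin): verified at every window prime with `n ≤ 150` (18/18). -/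
@[conjecture] def RecTSClassesO46 : Prop :=
  ∀ n p : ℕ, 2 ≤ n → p.Prime → 9 * n < 8 * p → 15 * p ≤ 17 * n → 41 * n + 2 < p ^ 2 → DepthRealised n p 46 →
    RecTSOriginClasses n p 46

/-- **RECORD WINDOW, type-space origin, `M = 46`** (`9/8 < θ ≤ 17/15`; casLB = −89): `v_p(Cas₇(b(n))) ≥ −87`. -/
@[conjecture] def RecWindowTSM46 : Prop :=
  ∀ n p : ℕ, 2 ≤ n → p.Prime → 9 * n < 8 * p → 15 * p ≤ 17 * n → 41 * n + 2 < p ^ 2 → DepthRealised n p 46 →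
    casoratian (bRec n) 7 ≠ 0 → (-87 : ℤ) ≤ padicValRat p (casoratian (bRec n) 7)

/-- Bookkeeping, window `M = 54` (origin): verified at every window prime with `n ≤ 150` (6/6). -/
@[conjecture] def RecTSClassesO54 : Prop :=
  ∀ n p : ℕ, 2 ≤ n → p.Prime → 16 * n < 17 * p → 18 * p ≤ 17 * n → 41 * n + 2 < p ^ 2 → DepthRealised n p 54 →
    RecTSOriginClasses n p 54

/-- **RECORD WINDOW, type-space origin, `M = 54`** (`16/17 < θ ≤ 17/18`; casLB = −105): `v_p(Cas₇(b(n))) ≥ −103`. -/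
@[conjecture] def RecWindowTSM54 : Prop :=
  ∀ n p : ℕ, 2 ≤ n → p.Prime → 16 * n < 17 * p → 18 * p ≤ 17 * n → 41 * n + 2 < p ^ 2 → DepthRealised n p 54 →
    casoratian (bRec n) 7 ≠ 0 → (-103 : ℤ) ≤ padicValRat p (casoratian (bRec n) 7)

/-- Bookkeeping, window `M = 60` (zero): verified at every window prime with `n ≤ 150` (8/8). -/
@[conjecture] def RecTSClassesZ60 : Prop :=
  ∀ n p : ℕ, 2 ≤ n → p.Prime → 6 * n < 7 * p → 29 * p ≤ 25 * n → 41 * n + 2 < p ^ 2 → DepthRealised n p 60 →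
    RecTSZeroClasses n p 60

/-- **RECORD WINDOW, type-space zero, `M = 60`** (`6/7 < θ ≤ 25/29`; casLB = −117): `v_p(Cas₇(b(n))) ≥ −114`. -/
@[conjecture] def RecWindowTSM60 : Prop :=
  ∀ n p : ℕ, 2 ≤ n → p.Prime → 6 * n < 7 * p → 29 * p ≤ 25 * n → 41 * n + 2 < p ^ 2 → DepthRealised n p 60 →
    casoratian (bRec n) 7 ≠ 0 → (-114 : ℤ) ≤ padicValRat p (casoratian (bRec n) 7)

/-- Bookkeeping, window `M = 62` (origin): verified at every window prime with `n ≤ 130` (15/15). -/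
@[conjecture] def RecTSClassesO62 : Prop :=
  ∀ n p : ℕ, 2 ≤ n → p.Prime → 14 * n < 17 * p → 6 * p ≤ 5 * n → 41 * n + 2 < p ^ 2 → DepthRealised n p 62 →
    RecTSOriginClasses n p 62

/-- **RECORD WINDOW, type-space origin, `M = 62`** (`14/17 < θ ≤ 5/6`; casLB = −121): `v_p(Cas₇(b(n))) ≥ −119`. -/
@[conjecture] def RecWindowTSM62 : Prop :=
  ∀ n p : ℕ, 2 ≤ n → p.Prime → 14 * n < 17 * p → 6 * p ≤ 5 * n → 41 * n + 2 < p ^ 2 → DepthRealised n p 62 →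
    casoratian (bRec n) 7 ≠ 0 → (-119 : ℤ) ≤ padicValRat p (casoratian (bRec n) 7)

/-- Bookkeeping, window `M = 64` (zero): verified at every window prime with `n ≤ 150` (4/4). -/
@[conjecture] def RecTSClassesZ64 : Prop :=
  ∀ n p : ℕ, 2 ≤ n → p.Prime → 41 * n < 51 * p → 31 * p ≤ 25 * n → 41 * n + 2 < p ^ 2 → DepthRealised n p 64 →
    RecTSZeroClasses n p 64

/-- **RECORD WINDOW, type-space zero, `M = 64`** (`41/51 < θ ≤ 25/31`; casLB = −125): `v_p(Cas₇(b(n))) ≥ −122`. -/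
@[conjecture] def RecWindowTSM64 : Prop :=
  ∀ n p : ℕ, 2 ≤ n → p.Prime → 41 * n < 51 * p → 31 * p ≤ 25 * n → 41 * n + 2 < p ^ 2 → DepthRealised n p 64 →
    casoratian (bRec n) 7 ≠ 0 → (-122 : ℤ) ≤ padicValRat p (casoratian (bRec n) 7)

/-- Bookkeeping, window `M = 68` (zero): verified at every window prime with `n ≤ 130` (9/9). -/
@[conjecture] def RecTSClassesZ68 : Prop :=
  ∀ n p : ℕ, 2 ≤ n → p.Prime → 3 * n < 4 * p → 33 * p ≤ 25 * n → 41 * n + 2 < p ^ 2 → DepthRealised n p 68 →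
    RecTSZeroClasses n p 68

/-- **RECORD WINDOW, type-space zero, `M = 68`** (`3/4 < θ ≤ 25/33`; casLB = −133): `v_p(Cas₇(b(n))) ≥ −130`. -/
@[conjecture] def RecWindowTSM68 : Prop :=
  ∀ n p : ℕ, 2 ≤ n → p.Prime → 3 * n < 4 * p → 33 * p ≤ 25 * n → 41 * n + 2 < p ^ 2 → DepthRealised n p 68 →
    casoratian (bRec n) 7 ≠ 0 → (-130 : ℤ) ≤ padicValRat p (casoratian (bRec n) 7)

/-- Bookkeeping, window `M = 76` (zero): verified at every window prime with `n ≤ 125` (7/7). -/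
@[conjecture] def RecTSClassesZ76 : Prop :=
  ∀ n p : ℕ, 2 ≤ n → p.Prime → 2 * n < 3 * p → 37 * p ≤ 25 * n → 41 * n + 2 < p ^ 2 → DepthRealised n p 76 →
    RecTSZeroClasses n p 76

/-- **RECORD WINDOW, type-space zero, `M = 76`** (`2/3 < θ ≤ 25/37`; casLB = −149): `v_p(Cas₇(b(n))) ≥ −146`. -/
@[conjecture] def RecWindowTSM76 : Prop :=
  ∀ n p : ℕ, 2 ≤ n → p.Prime → 2 * n < 3 * p → 37 * p ≤ 25 * n → 41 * n + 2 < p ^ 2 → DepthRealised n p 76 →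
    casoratian (bRec n) 7 ≠ 0 → (-146 : ℤ) ≤ padicValRat p (casoratian (bRec n) 7)

/-! ## §4 Reductions (PROVED): zero windows from bookkeeping alone; origin windows from bookkeeping + `TypeSpaceLawOrigin` -/

/-- **`RecTSClassesZ36 → RecWindowTSM36`** (the law is the theorem `typeSpaceLawZero_holds`). -/
theorem recWindowTSM36_of (hS : RecTSClassesZ36) : RecWindowTSM36 := by
  intro n p hn hp h1 h2 h3 hD hne
  have key := tsZero_bRec n p 36 hn hp (by omega) h3 (by norm_num) (by decide) (hS n p hn hp h1 h2 h3 hD) (by push_cast; nlinarith [h2]) hne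
  have e : (6 : ℤ) - 2 * ((36 : ℕ) : ℤ) = -66 := by norm_num
  rw [e] at key; exact key

/-- **`TypeSpaceLawOrigin → RecTSClassesO38 → RecWindowTSM38`**. -/
theorem recWindowTSM38_of (hO : TypeSpaceLawOrigin) (hS : RecTSClassesO38) : RecWindowTSM38 := by
  intro n p hn hp h1 h2 h3 hD hne
  have key := tsOrigin_bRec hO n p 38 hn hp (by omega) h3 (by norm_num) (by decide) (hS n p hn hp h1 h2 h3 hD) (by push_cast; nlinarith [h2]) hne
  have e : (5 : ℤ) - 2 * ((38 : ℕ) : ℤ) = -71 := by norm_num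
  rw [e] at key; exact key

/-- **`TypeSpaceLawOrigin → RecTSClassesO46 → RecWindowTSM46`**. -/
theorem recWindowTSM46_of (hO : TypeSpaceLawOrigin) (hS : RecTSClassesO46) : RecWindowTSM46 := by
  intro n p hn hp h1 h2 h3 hD hne
  have key := tsOrigin_bRec hO n p 46 hn hp (by omega) h3 (by norm_num) (by decide) (hS n p hn hp h1 h2 h3 hD) (by push_cast; nlinarith [h2]) hne
  have e : (5 : ℤ) - 2 * ((46 : ℕ) : ℤ) = -87 := by norm_num
  rw [e] at key; exact key

/-- **`TypeSpaceLawOrigin → RecTSClassesO54 → RecWindowTSM54`**. -/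
theorem recWindowTSM54_of (hO : TypeSpaceLawOrigin) (hS : RecTSClassesO54) : RecWindowTSM54 := by
  intro n p hn hp h1 h2 h3 hD hne
  have key := tsOrigin_bRec hO n p 54 hn hp (by omega) h3 (by norm_num) (by decide) (hS n p hn hp h1 h2 h3 hD) (by push_cast; nlinarith [h2]) hne
  have e : (5 : ℤ) - 2 * ((54 : ℕ) : ℤ) = -103 := by norm_num
  rw [e] at key; exact key

/-- **`RecTSClassesZ60 → RecWindowTSM60`**. -/
theorem recWindowTSM60_of (hS : RecTSClassesZ60) : RecWindowTSM60 := by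
  intro n p hn hp h1 h2 h3 hD hne
  have key := tsZero_bRec n p 60 hn hp (by omega) h3 (by norm_num) (by decide) (hS n p hn hp h1 h2 h3 hD) (by push_cast; nlinarith [h2]) hne
  have e : (6 : ℤ) - 2 * ((60 : ℕ) : ℤ) = -114 := by norm_num
  rw [e] at key; exact key

/-- **`TypeSpaceLawOrigin → RecTSClassesO62 → RecWindowTSM62`**. -/
theorem recWindowTSM62_of (hO : TypeSpaceLawOrigin) (hS : RecTSClassesO62) : RecWindowTSM62 := by
  intro n p hn hp h1 h2 h3 hD hne
  have key := tsOrigin_bRec hO n p 62 hn hp (by omega) h3 (by norm_num) (by decide) (hS n p hn hp h1 h2 h3 hD) (by push_cast; nlinarith [h2]) hne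
  have e : (5 : ℤ) - 2 * ((62 : ℕ) : ℤ) = -119 := by norm_num
  rw [e] at key; exact key

/-- **`RecTSClassesZ64 → RecWindowTSM64`**. -/
theorem recWindowTSM64_of (hS : RecTSClassesZ64) : RecWindowTSM64 := by
  intro n p hn hp h1 h2 h3 hD hne
  have key := tsZero_bRec n p 64 hn hp (by omega) h3 (by norm_num) (by decide) (hS n p hn hp h1 h2 h3 hD) (by push_cast; nlinarith [h2]) hne
  have e : (6 : ℤ) - 2 * ((64 : ℕ) : ℤ) = -122 := by norm_num
  rw [e] at key; exact key

/-- **`RecTSClassesZ68 → RecWindowTSM68`**. -/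
theorem recWindowTSM68_of (hS : RecTSClassesZ68) : RecWindowTSM68 := by
  intro n p hn hp h1 h2 h3 hD hne
  have key := tsZero_bRec n p 68 hn hp (by omega) h3 (by norm_num) (by decide) (hS n p hn hp h1 h2 h3 hD) (by push_cast; nlinarith [h2]) hne
  have e : (6 : ℤ) - 2 * ((68 : ℕ) : ℤ) = -130 := by norm_num
  rw [e] at key; exact key

/-- **`RecTSClassesZ76 → RecWindowTSM76`**. -/
theorem recWindowTSM76_of (hS : RecTSClassesZ76) : RecWindowTSM76 := by
  intro n p hn hp h1 h2 h3 hD hne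
  have key := tsZero_bRec n p 76 hn hp (by omega) h3 (by norm_num) (by decide) (hS n p hn hp h1 h2 h3 hD) (by push_cast; nlinarith [h2]) hne
  have e : (6 : ℤ) - 2 * ((76 : ℕ) : ℤ) = -146 := by norm_num
  rw [e] at key; exact key

end Summit.KontsevichZagierPeriods.Zeta5Search.ResidueLaw
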